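import Mathlib.NumberTheory.ArithmeticFunction.Moebius
import Mathlib.Analysis.Asymptotics.Lemmas
import Mathlib.Analysis.Complex.Basic
import Literature.NumberTheory.LFunctions.MoebiusAutomatic
import HarnessLib

/-!
# Müllner's theorem: the partial sums `∑_{n ≤ N} a(n) μ(n)` and the first reductions (proved)

Everything in this file is PROVED. It opens the formalisation of the printed proof of
`Literature.NumberTheory.LFunctions.mullner_moebius_automatic` (C. Müllner, *Automatic sequences
fulfill the Sarnak conjecture*, Duke Math. J. 166 (2017), Thm. 1.2) with the bookkeeping that
the paper uses silently in §3.1 (p. 15: "We assume for simplicity that `|a_n| ≤ 1`"):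

* `moebiusSum a N = ∑_{n ≤ N} a(n) μ(n)` and the dictionary between the `ε`–`N₀` form of the fact
  and Mathlib's `=o[atTop]` (`moebiusSum_isLittleO_iff`, `mullner_moebius_automatic_iff_isLittleO`);
* linearity of `a ↦ moebiusSum a` and the `L¹`-approximation principle
  (`isLittleO_moebiusSum_of_l1Approx`): if `a` is, for every `δ > 0`, within `δ N` in
  `∑_{n ≤ N} ‖a n − b n‖` of a Möbius-orthogonal `b`, then `a` is Möbius-orthogonal — the form in
  which density-one sets of "good" integers are discarded in Müllner's Prop. 3.3;
* structure of the `k`-kernel hypothesis `IsAutomaticSeq` (`MultiplicativeAutomatic.lean`):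
  images under maps (`IsAutomaticSeq.comp`), finiteness of the range for `k ≥ 2`
  (`IsAutomaticSeq.finite_range`), and the reduction of the fact to `{0,1}`-valued automatic
  sequences (`mullner_moebius_automatic_of_indicator`), by `a = ∑_{c ∈ range a} c · 𝟙_{a = c}`.

## References
* C. Müllner, Duke Math. J. 166 (2017) 3219–3290 = arXiv:1602.03042, §3.1. [Mullner2017]
* J.-P. Allouche, J. Shallit, *Automatic Sequences*, CUP 2003, Thm. 6.6.2 (kernel
  characterisation), Thm. 5.4.? / Cor. 6.6.? (images, finite range). [AlloucheShallit2003]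
-/

noncomputable section

open Finset Filter Asymptotics
open scoped ArithmeticFunction.Moebius

namespace Literature.NumberTheory.LFunctions

/-! ## The partial sums and the `o(N)` dictionary -/

/-- The Möbius partial sums of a sequence: `moebiusSum a N = ∑_{n ≤ N} a(n) μ(n)` (the sum over
`n ∈ {0, …, N}`; the term `n = 0` vanishes since `μ(0) = 0`). [folklore] -/
def moebiusSum (a : ℕ → ℂ) (N : ℕ) : ℂ :=
  ∑ n ∈ range (N + 1), a n * (μ n : ℂ)

/-- Unfolding lemma for `moebiusSum`. [folklore] -/
theorem moebiusSum_apply (a : ℕ → ℂ) (N : ℕ) :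
    moebiusSum a N = ∑ n ∈ range (N + 1), a n * (μ n : ℂ) := rfl

/-- `|μ(n)| ≤ 1` in `ℂ`. [folklore] -/
theorem norm_moebius_cast_le_one (n : ℕ) : ‖(μ n : ℂ)‖ ≤ 1 := by
  rw [Complex.norm_intCast]
  exact_mod_cast ArithmeticFunction.abs_moebius_le_one

/-- The `ε`–`N₀` form used in `mullner_moebius_automatic` is Mathlib's
`moebiusSum a =o[atTop] (N ↦ N)`. [folklore] -/
theorem moebiusSum_isLittleO_iff (a : ℕ → ℂ) :
    (moebiusSum a =o[atTop] fun N : ℕ => (N : ℝ)) ↔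
      ∀ ε : ℝ, 0 < ε → ∃ N₀ : ℕ, ∀ N : ℕ, N₀ ≤ N →
        ‖∑ n ∈ range (N + 1), a n * (ArithmeticFunction.moebius n : ℂ)‖ ≤ ε * N := by
  simp only [isLittleO_iff, eventually_atTop, Real.norm_natCast, moebiusSum]

/-- **Dictionary.** Müllner's theorem in the tree's `ε`–`N₀` form is equivalent to the `=o[atTop]`
form `moebiusSum a = o(N)` for every `k ≥ 2` and every `k`-automatic `a`. [folklore] -/
theorem mullner_moebius_automatic_iff_isLittleO :
    mullner_moebius_automatic ↔ ∀ k : ℕ, 2 ≤ k → ∀ a : ℕ → ℂ, IsAutomaticSeq k a →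
      moebiusSum a =o[atTop] fun N : ℕ => (N : ℝ) := by
  simp only [mullner_moebius_automatic, moebiusSum_isLittleO_iff]

/-! ## Linearity and the `L¹`-approximation principle -/

/-- `moebiusSum` is additive in the sequence. [folklore] -/
theorem moebiusSum_add (a b : ℕ → ℂ) (N : ℕ) :
    moebiusSum (fun n => a n + b n) N = moebiusSum a N + moebiusSum b N := by
  simp only [moebiusSum, add_mul, sum_add_distrib]

/-- `moebiusSum` is homogeneous in the sequence. [folklore] -/
theorem moebiusSum_const_mul (c : ℂ) (a : ℕ → ℂ) (N : ℕ) :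
    moebiusSum (fun n => c * a n) N = c * moebiusSum a N := by
  simp only [moebiusSum, mul_sum, mul_assoc]

/-- `moebiusSum` of a finite sum of sequences. [folklore] -/
theorem moebiusSum_finset_sum {ι : Type*} (s : Finset ι) (a : ι → ℕ → ℂ) (N : ℕ) :
    moebiusSum (fun n => ∑ i ∈ s, a i n) N = ∑ i ∈ s, moebiusSum (a i) N := by
  simp only [moebiusSum, sum_mul]
  exact sum_comm

/-- `‖M_a(N) − M_b(N)‖ ≤ ∑_{n ≤ N} ‖a n − b n‖` (since `|μ| ≤ 1`). [folklore] -/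
theorem norm_moebiusSum_sub_le (a b : ℕ → ℂ) (N : ℕ) :
    ‖moebiusSum a N - moebiusSum b N‖ ≤ ∑ n ∈ range (N + 1), ‖a n - b n‖ := by
  rw [moebiusSum, moebiusSum, ← sum_sub_distrib]
  refine (norm_sum_le _ _).trans (sum_le_sum fun n _ => ?_)
  rw [← sub_mul, norm_mul]
  exact mul_le_of_le_one_right (norm_nonneg _) (norm_moebius_cast_le_one n)

/-- The trivial bound `‖M_a(N)‖ ≤ ∑_{n ≤ N} ‖a n‖`. [folklore] -/
theorem norm_moebiusSum_le (a : ℕ → ℂ) (N : ℕ) :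
    ‖moebiusSum a N‖ ≤ ∑ n ∈ range (N + 1), ‖a n‖ := by
  simpa [moebiusSum] using norm_moebiusSum_sub_le a (fun _ => 0) N

/-- Möbius orthogonality is preserved under sums. [folklore] -/
theorem isLittleO_moebiusSum_add {a b : ℕ → ℂ}
    (ha : moebiusSum a =o[atTop] fun N : ℕ => (N : ℝ))
    (hb : moebiusSum b =o[atTop] fun N : ℕ => (N : ℝ)) :
    moebiusSum (fun n => a n + b n) =o[atTop] fun N : ℕ => (N : ℝ) := by
  have : moebiusSum (fun n => a n + b n) = fun N => moebiusSum a N + moebiusSum b N :=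
    funext (moebiusSum_add a b)
  rw [this]
  exact ha.add hb

/-- Möbius orthogonality is preserved under scalar multiples. [folklore] -/
theorem isLittleO_moebiusSum_const_mul {a : ℕ → ℂ} (c : ℂ)
    (ha : moebiusSum a =o[atTop] fun N : ℕ => (N : ℝ)) :
    moebiusSum (fun n => c * a n) =o[atTop] fun N : ℕ => (N : ℝ) := by
  have : moebiusSum (fun n => c * a n) = fun N => c * moebiusSum a N :=
    funext (moebiusSum_const_mul c a)
  rw [this]
  exact ha.const_mul_left c

/-- Möbius orthogonality is preserved under finite linear combinations. [folklore] -/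
theorem isLittleO_moebiusSum_finset_sum {ι : Type*} (s : Finset ι) {a : ι → ℕ → ℂ}
    (ha : ∀ i ∈ s, moebiusSum (a i) =o[atTop] fun N : ℕ => (N : ℝ)) :
    moebiusSum (fun n => ∑ i ∈ s, a i n) =o[atTop] fun N : ℕ => (N : ℝ) := by
  have : moebiusSum (fun n => ∑ i ∈ s, a i n) = fun N => ∑ i ∈ s, moebiusSum (a i) N :=
    funext (moebiusSum_finset_sum s a)
  rw [this]
  exact IsLittleO.sum ha

/-- **`L¹`-approximation principle** (the form in which Müllner, Prop. 3.3, discards the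
complement of a density-one set of integers at the cost of `ε N/3`): if for every `δ > 0` there
is a Möbius-orthogonal `b` with `∑_{n ≤ N} ‖a n − b n‖ ≤ δ N` for all large `N`, then `a` is
Möbius-orthogonal. [cite: Mullner2017, Prop. 3.3 (proof)] -/
theorem isLittleO_moebiusSum_of_l1Approx {a : ℕ → ℂ}
    (h : ∀ δ : ℝ, 0 < δ → ∃ b : ℕ → ℂ, (moebiusSum b =o[atTop] fun N : ℕ => (N : ℝ)) ∧
      ∀ᶠ N : ℕ in atTop, ∑ n ∈ range (N + 1), ‖a n - b n‖ ≤ δ * N) :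
    moebiusSum a =o[atTop] fun N : ℕ => (N : ℝ) := by
  rw [isLittleO_iff]
  intro ε hε
  obtain ⟨b, hb, hab⟩ := h (ε / 2) (half_pos hε)
  filter_upwards [hab, hb.def (half_pos hε)] with N h1 h2
  rw [Real.norm_natCast] at h2 ⊢
  calc ‖moebiusSum a N‖ = ‖(moebiusSum a N - moebiusSum b N) + moebiusSum b N‖ := by
        rw [sub_add_cancel]
    _ ≤ ‖moebiusSum a N - moebiusSum b N‖ + ‖moebiusSum b N‖ := norm_add_le _ _
    _ ≤ ε / 2 * N + ε / 2 * N := add_le_add ((norm_moebiusSum_sub_le a b N).trans h1) h2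
    _ = ε * N := by ring

/-- Finite modifications do not affect Möbius orthogonality: if `a n = b n` for all `n ≥ n₀` and
`b` is Möbius-orthogonal then so is `a`. [folklore] -/
theorem isLittleO_moebiusSum_congr_eventually {a b : ℕ → ℂ} {n₀ : ℕ}
    (hab : ∀ n, n₀ ≤ n → a n = b n) (hb : moebiusSum b =o[atTop] fun N : ℕ => (N : ℝ)) :
    moebiusSum a =o[atTop] fun N : ℕ => (N : ℝ) := by
  refine isLittleO_moebiusSum_of_l1Approx fun δ hδ => ⟨b, hb, ?_⟩
  set C : ℝ := ∑ n ∈ range n₀, ‖a n - b n‖ with hC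
  have hbound : ∀ N : ℕ, ∑ n ∈ range (N + 1), ‖a n - b n‖ ≤ C := by
    intro N
    calc ∑ n ∈ range (N + 1), ‖a n - b n‖
        = ∑ n ∈ (range (N + 1)).filter (fun n => n < n₀), ‖a n - b n‖ := by
          rw [sum_filter]
          refine sum_congr rfl fun n _ => ?_
          split_ifs with h
          · rfl
          · rw [hab n (not_lt.1 h), sub_self, norm_zero]
      _ ≤ ∑ n ∈ range n₀, ‖a n - b n‖ := by
          refine sum_le_sum_of_subset_of_nonneg (fun n hn => ?_) fun _ _ _ => norm_nonneg _
          simp only [mem_filter, mem_range] at hn ⊢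
          exact hn.2
  obtain ⟨N₁, hN₁⟩ := exists_nat_gt (C / δ)
  refine eventually_atTop.2 ⟨N₁, fun N hN => (hbound N).trans ?_⟩
  have : C / δ ≤ N := hN₁.le.trans (by exact_mod_cast hN)
  rwa [div_le_iff₀ hδ, mul_comm] at this

/-! ## Structure of the `k`-kernel hypothesis -/

/-- The `k`-kernel of `Φ ∘ a` is the image of the `k`-kernel of `a`; hence images of automatic
sequences are automatic (Allouche–Shallit, Cor. of Thm. 6.6.2; Coons 2010 Lemma 1.6).
[folklore] -/
theorem IsAutomaticSeq.comp {k : ℕ} {a : ℕ → ℂ} (h : IsAutomaticSeq k a) (Φ : ℂ → ℂ) :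
    IsAutomaticSeq k (Φ ∘ a) := by
  refine (h.image fun g => Φ ∘ g).subset ?_
  rintro g ⟨i, hi, r, hr, rfl⟩
  exact ⟨fun n => a (k ^ i * n + r), ⟨i, hi, r, hr, rfl⟩, rfl⟩

/-- Every value `a n` is the value at `0` of a kernel element (`k ≥ 2`: take `i` with
`n < k^i`). [folklore] -/
theorem IsAutomaticSeq.range_subset_image {k : ℕ} (hk : 2 ≤ k) (a : ℕ → ℂ) :
    Set.range a ⊆ (fun g : ℕ → ℂ => g 0) '' qKernel k a := by
  rintro _ ⟨n, rfl⟩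
  have hn : n < k ^ (n + 1) :=
    (Nat.lt_two_pow_self).trans_le
      ((Nat.pow_le_pow_left hk n).trans (Nat.pow_le_pow_right (by omega) (Nat.le_succ n)))
  exact ⟨fun m => a (k ^ (n + 1) * m + n), ⟨n + 1, Nat.succ_pos n, n, hn, rfl⟩, by simp⟩

/-- A `k`-automatic sequence (`k ≥ 2`) takes only finitely many values (Allouche–Shallit: an
automatic sequence is the image of the finite state set under the output map). [folklore] -/
theorem IsAutomaticSeq.finite_range {k : ℕ} (hk : 2 ≤ k) {a : ℕ → ℂ} (h : IsAutomaticSeq k a) :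
    (Set.range a).Finite :=
  (h.image _).subset (IsAutomaticSeq.range_subset_image hk a)

/-- The level sets of an automatic sequence are automatic: `𝟙_{a = c}` is `k`-automatic.
[folklore] -/
theorem IsAutomaticSeq.indicator_fiber {k : ℕ} {a : ℕ → ℂ} (h : IsAutomaticSeq k a) (c : ℂ) :
    IsAutomaticSeq k (fun n => if a n = c then (1 : ℂ) else 0) :=
  h.comp fun z => if z = c then (1 : ℂ) else 0

/-- Decomposition of a sequence with finite range along its level sets:
`a = ∑_{c ∈ range a} c · 𝟙_{a = c}`. [folklore] -/
theorem eq_sum_indicator_fiber {a : ℕ → ℂ} (h : (Set.range a).Finite) (n : ℕ) :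
    a n = ∑ c ∈ h.toFinset, c * (if a n = c then (1 : ℂ) else 0) := by
  have hn : a n ∈ h.toFinset := by simp
  simp only [mul_ite, mul_one, mul_zero]
  rw [Finset.sum_ite_eq h.toFinset (a n) (fun c => c)]
  simp [hn]

/-- **Reduction to `{0,1}`-valued sequences** (Müllner §3.1, "we assume for simplicity that
`|a_n| ≤ 1`", in the sharper standard form): Müllner's theorem follows from its special case for
`{0,1}`-valued `k`-automatic sequences, by `a = ∑_{c ∈ range a} c · 𝟙_{a = c}` and linearity.
[cite: Mullner2017, §3.1] -/
theorem mullner_moebius_automatic_of_indicator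
    (H : ∀ k : ℕ, 2 ≤ k → ∀ a : ℕ → ℂ, IsAutomaticSeq k a → (∀ n, a n = 0 ∨ a n = 1) →
      moebiusSum a =o[atTop] fun N : ℕ => (N : ℝ)) :
    mullner_moebius_automatic := by
  rw [mullner_moebius_automatic_iff_isLittleO]
  intro k hk a ha
  have hfin := ha.finite_range hk
  have heq : moebiusSum a =
      moebiusSum (fun n => ∑ c ∈ hfin.toFinset, c * (if a n = c then (1 : ℂ) else 0)) := by
    congr 1
    exact funext (eq_sum_indicator_fiber hfin)
  rw [heq]
  refine isLittleO_moebiusSum_finset_sum _ fun c _ => isLittleO_moebiusSum_const_mul c ?_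
  refine H k hk _ (ha.indicator_fiber c) fun n => ?_
  by_cases h : a n = c <;> simp [h]

end Literature.NumberTheory.LFunctions
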